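import Literature.MathematicalPhysics.QuantumFieldTheory.Balaban1983to89.B13Core214HolomorphicPrimitive

/-!
# `Balaban1983to89.B13Core214HolomorphicCapstone` — T. Bałaban, *Renormalization group approach to lattice gauge field
theories. II. Cluster expansions*, Commun. Math. Phys. **116** (1988) 1–22 [Balaban1988RG2Cluster], pp. 15–17: the (2.26)
capstone of the tree (`B13Bound226Located.norm_term214_le_226_of_primitives`) WITHOUT its two regularity hypotheses
`hΨσ`, `hΨτ` (*"We consider it as an analytic function … of the complex parameters σ(Z), τ"*) — both DERIVED from the
primitive data (`B13Core214HolomorphicPrimitive.sepHolOn_core214_sigma_of_primitives`, `B13Core214Holomorphic.sepHolOn_core214_tau`)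

statement-level skeleton of published theorems with citation tags; proofs where landed; nothing here is a claim about
the Yang–Mills mass gap

WHAT IS PROVED HERE (cell `pub-balaban-gaps`, seat ne5 gen 6).  `norm_term214_le_226_of_primitives_holo`: the capstone's
hypothesis list with (i) `hΨσ`, `hΨτ` REMOVED; (ii) the σ-letters (`hAs hA hlin hG hCs hdΓ hdC hdE`) asked on the OPEN polydisc
`{σ | ∀ j, σ j ∈ Uσ}` (which contains the closed `e^{κ₁}`-ball by `hUexp`) instead of the closed ball — print's «analytic on a
neighbourhood of the contour»; (iii) ADDED: entrywise holomorphy of `A(σ)`, `G(σ)` there, measurability of `χ_{k,Y₀}`, `χᶜ_{k,P}`,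
`𝐕_k(Y,·)`, and (2.20) UNIFORMLY on the τ-polydisc `{τ | ∀ Y, τ Y ∈ Uτ}` (`h220U` — STRONGER than print's per-domain radii
(2.18) because the tree's `SepHolOn Uτ` is a single-open-set shape, cell record (x8); the capstone's own `h220R` at the radii
`R_τ(Y)` is the point `τ = (R_τ(Y))_Y` of that polydisc and is DERIVED, one binder fewer).  Same conclusion, same constants.
LOCATED JUNCTION POINT (cell records (x8), X-H4-1): `h220U` with ONE open `Uτ ⊇` every closed disc `{|τ| ≤ R_τ(Y)}` contains
(2.20) at the UNIFORM radius `max_Y R_τ(Y)`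
in every coordinate with the same `(a, w)` as the capstone's `h220R`, so `w` is torus-size dependent for print's growing radii: the theorem
is true and honest on ONE finite torus, but `h220U` is TORUS-UNIFORM only in the per-coordinate version (`Uτ : κ → Set ℂ`,
(2.20) over `∀ Y, τ Y ∈ Uτ Y`); across-tori consumers wait for that `SepHolOnPoly` form (`B13Bound226LocatedPoly`).  For σ fixed
in the open polydisc the τ-slot's letters are derived by the capstone's five lines (`h216R1_of_factors` → `hR1_of_entrywise`, …) —
`sepHolOn_core214_tau_of_primitives`.

HONEST FRAMING.  Generic finite-dimensional complex analysis over the block model; every kernel family and letter is a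
HYPOTHESIS; nothing of Bałaban's constructed; (D4) 0∕1, spine 0∕9 UNCHANGED; NOT continuum, NOT mass gap, NOT Clay.  0 sorry, 0 `def`.
-/

noncomputable section

namespace Literature.MathematicalPhysics.QuantumFieldTheory.Balaban1983to89.B13Core214HolomorphicCapstone

open Matrix MeasureTheory Finset Complex Metric Set
open scoped Real
open B13PerturbativeStep (WeightHyp)
open B13Term214 (core214 F214 SepHolOn term214)
open B13Eq216FirstForm (hdef1_of_linear)
open B13Bound226Primitive (hdef3_of_linear h216R3_of_diff continuous_of_linear)
open B13Bound226Located (h216R1_of_factors hR1_of_entrywise hR2_of_entrywise hR3_of_entrywise h17a_of_entrywise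
  h17b_of_entrywise entry_bound_mono_rate norm_term214_le_226_of_primitives)
open B13Integral223 (norm_F214_le)
open B13Core214Holomorphic (sepHolOn_core214_tau measurable_F214)
open B13Core214HolomorphicPrimitive (sepHolOn_core214_sigma_of_primitives)

variable {S : Type*} [DecidableEq S] {ρ : S → S → ℝ} {Kc : ℝ → ℝ}
variable {Λ : Type} [Fintype Λ] [DecidableEq Λ] {C₀ : Type} [Fintype C₀] [DecidableEq C₀]
variable {ι κ : Type*} [Fintype ι] [DecidableEq ι] [Fintype κ] [DecidableEq κ]

omit [Fintype ι] [DecidableEq ι] in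
/-- **THE τ-SLOT `hΨτ` FROM THE PRIMITIVE OBJECTS at a σ of the open polydisc** (the letters at that σ by the capstone's five
lines; Gaussian growth of the printed last line by `norm_F214_le` from (2.22) and (2.20) UNIFORM on the τ-polydisc, (x8)).
[cite: Balaban1988RG2Cluster, (2.14)–(2.15) p.15, (2.16)–(2.22) p.16, (2.23)–(2.25) p.17] -/
theorem sepHolOn_core214_tau_of_primitives (hρ : WeightHyp 0 ρ) (hρs : ∀ x y : S, ρ x y = ρ y x)
    (hKc : ∀ b : ℝ, 0 < b → ∀ (T : Finset S) (x : S), ∑ y ∈ T, Real.exp (-(b * ρ x y)) ≤ Kc b)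
    (hKc0 : ∀ b : ℝ, 0 < b → 0 ≤ Kc b)
    {Uτ : Set ℂ} (hUτ : IsOpen Uτ)
    (A : (ι → ℂ) → Matrix Λ Λ ℂ) (Γ : (ι → ℂ) → (Λ ⊕ C₀ → ℝ) → (Λ → ℂ)) (G : (ι → ℂ) → Matrix Λ (Λ ⊕ C₀) ℂ)
    (σ : ι → ℂ) (hAs : (A σ).IsSymm) (hA : ((A σ).map Complex.re).PosDef)
    (hlin : ∀ X : Λ ⊕ C₀ → ℝ, Γ σ X = G σ *ᵥ fun j => (X j : ℂ))
    (cardP : ℕ) {χY₀ χcP : (Λ → ℝ) → ℝ} (hχm : Measurable χY₀) (hχcm : Measurable χcP)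
    (hχ0 : ∀ B, 0 ≤ χY₀ B) (hχc0 : ∀ B, 0 ≤ χcP B) (Dfam : Finset κ) {V : κ → (Λ → ℝ) → ℂ}
    (hVm : ∀ Y, Measurable (V Y)) {γ₂ rP a w : ℝ} (qP : (Λ → ℝ) → ℝ)
    (h222 : ∀ B, χY₀ B * χcP B ≤ Real.exp (-(γ₂ / 2 * rP ^ 2 * cardP) + γ₂ / 2 * qP B)) (hγ₂ : 0 ≤ γ₂)
    (hqP : ∀ B, qP B ≤ B ⬝ᵥ B) (ha0 : 0 ≤ a)
    (h220U : ∀ τ : κ → ℂ, (∀ Y, τ Y ∈ Uτ) → ∀ B, ∑ Y ∈ Dfam, ‖τ Y‖ * ‖V Y B‖ ≤ a / 2 * (B ⬝ᵥ B) + w)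
    {C : Matrix Λ Λ ℝ} (hC : C.PosDef) (Γ₀ : Matrix Λ (Λ ⊕ C₀) ℝ)
    (locΛ : Λ → S) (locN : Λ ⊕ C₀ → S) {m : ℕ}
    (hfibΛ : ∀ x : S, (Finset.univ.filter fun i => locΛ i = x).card ≤ m)
    (hfibN : ∀ x : S, (Finset.univ.filter fun j => locN j = x).card ≤ m)
    {kap kap' kap'' θ θE θΓ θC KG KΓ KCs K₀ : ℝ} (hkap'' : 0 < kap'') (h1 : kap'' < kap') (h2 : kap' < kap)
    (hθE : 0 ≤ θE) (hθΓ : 0 ≤ θΓ) (hθC : 0 ≤ θC) (hKG : 0 ≤ KG) (hKΓ : 0 ≤ KΓ) (hKCs : 0 ≤ KCs) (hK₀ : 0 ≤ K₀)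
    (hθEle : θE ≤ θ) (hθΓle : θΓ ≤ θ)
    (hθR1le : (m * Kc (kap - kap')) * (m * Kc (kap' - kap''))
      * (θΓ * KCs * KG + KΓ * θC * KG + KΓ * K₀ * θΓ) ≤ θ)
    (hG : ∀ b j, ‖G σ b j‖ ≤ KG * Real.exp (-(kap * ρ (locΛ b) (locN j))))
    (hΓ₀ : ∀ b j, ‖Γ₀ b j‖ ≤ KΓ * Real.exp (-(kap * ρ (locΛ b) (locN j))))
    (hCs : ∀ b b', ‖(A σ)⁻¹ b b'‖ ≤ KCs * Real.exp (-(kap * ρ (locΛ b) (locΛ b'))))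
    (hC216 : ∀ b b', ‖C b b'‖ ≤ K₀ * Real.exp (-(kap * ρ (locΛ b) (locΛ b'))))
    (hdΓ : ∀ b j, ‖(G σ - Γ₀.map (algebraMap ℝ ℂ)) b j‖ ≤ θΓ * Real.exp (-(kap * ρ (locΛ b) (locN j))))
    (hdC : ∀ b b', ‖((A σ)⁻¹ - C.map (algebraMap ℝ ℂ)) b b'‖ ≤ θC * Real.exp (-(kap * ρ (locΛ b) (locΛ b'))))
    (hdE : ∀ b b', ‖(A σ - C⁻¹.map (algebraMap ℝ ℂ)) b b'‖ ≤ θE * Real.exp (-(kap * ρ (locΛ b) (locΛ b'))))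
    (hsmallKθ : K₀ * (m * Kc kap) * (θ * (m * Kc kap'')) < 1)
    {c g : ℝ} (hc0 : 0 ≤ c) (hc : ∀ k, hC.1.eigenvalues k ≤ c)
    (hαc : (2 * (θ * (m * Kc kap'')) + (γ₂ + a)) * c ≤ 1 / 2)
    (hΓq : ∀ X : Λ ⊕ C₀ → ℝ, (Γ₀ *ᵥ X) ⬝ᵥ (C *ᵥ (Γ₀ *ᵥ X)) ≤ g * (X ⬝ᵥ X))
    (hsmall : (2 * (θ * (m * Kc kap'')) + (γ₂ + a)) * (1 + 2 * c * g) ≤ 1 / 2) :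
    SepHolOn Uτ (fun τ => core214 A Γ (F214 cardP χY₀ χcP Dfam V) σ τ) := by
  have hθ : 0 ≤ θ := hθE.trans hθEle
  have hkap : 0 < kap := hkap''.trans (h1.trans h2)
  have hkk : kap'' ≤ kap := (h1.trans h2).le
  have hρ0 : 0 ≤ θ * (m * Kc kap'') := mul_nonneg hθ (mul_nonneg (Nat.cast_nonneg m) (hKc0 _ hkap''))
  have h216R1 : ∀ b b', ‖(Γ₀ᵀ * C * Γ₀ - ((G σ)ᵀ * (A σ)⁻¹ * G σ).map Complex.re) b b'‖
      ≤ θ * Real.exp (-(kap'' * ρ (locN b) (locN b'))) := fun b b' =>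
    (h216R1_of_factors hρ hρs hKc hKc0 hθΓ hθC hKG hKΓ hKCs hK₀ hkap''.le h1 h2 locΛ locN hfibΛ
      hdΓ hdC hG hΓ₀ hCs hC216 b b').trans (mul_le_mul_of_nonneg_right hθR1le (Real.exp_pos _).le)
  have h216E : ∀ b b', ‖(A σ - C⁻¹.map (algebraMap ℝ ℂ)) b b'‖ ≤ θ * Real.exp (-(kap'' * ρ (locΛ b) (locΛ b'))) :=
    fun b b' => (entry_bound_mono_rate hρ hθE hkk locΛ locΛ hdE b b').trans
      (mul_le_mul_of_nonneg_right hθEle (Real.exp_pos _).le)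
  have h216R3 : ∀ i j, ‖((G σ).map Complex.re - Γ₀) i j‖ ≤ θ * Real.exp (-(kap'' * ρ (locΛ i) (locN j))) := by
    have hmono : ∀ i j, ‖(G σ - Γ₀.map (algebraMap ℝ ℂ)) i j‖ ≤ θ * Real.exp (-(kap'' * ρ (locΛ i) (locN j))) :=
      fun i j => (entry_bound_mono_rate hρ hθΓ hkk locΛ locN hdΓ i j).trans
        (mul_le_mul_of_nonneg_right hθΓle (Real.exp_pos _).le)
    exact fun i j => h216R3_of_diff hmono i j
  exact sepHolOn_core214_tau (ρ := θ * (m * Kc kap''))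
    (η := K₀ * (m * Kc kap) * (θ * (m * Kc kap'')) * (1 + (1 - K₀ * (m * Kc kap) * (θ * (m * Kc kap'')))⁻¹) / 2)
    (g := g) (Γ₀ := Γ₀) hUτ σ hAs hA (continuous_of_linear (G σ) (Γ σ) hlin) cardP hχm hχcm hχ0 hχc0 Dfam hVm qP
    h222 hγ₂ hqP ha0 h220U hC hρ0
    (fun X => hR1_of_entrywise hρ hρs hKc (Γ σ) Γ₀ _ hθ hkap'' locN hfibN
      (hdef1_of_linear (A σ) (G σ) (Γ σ) hlin C Γ₀) h216R1 X)
    (h17a_of_entrywise hρ hρs hKc hC hA hθ hkap'' hK₀ hkap locΛ hfibΛ hC216 h216E hsmallKθ)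
    (h17b_of_entrywise hρ hρs hKc hC hA hθ hkap'' hK₀ hkap locΛ hfibΛ hC216 h216E hsmallKθ)
    (fun B => hR2_of_entrywise hρ hρs hKc hθ hkap'' locΛ hfibΛ h216E B)
    (fun X B => hR3_of_entrywise hρs hKc (Γ σ) Γ₀ _ hθ hkap'' locΛ locN hfibΛ hfibN
      (hdef3_of_linear (G σ) (Γ σ) hlin Γ₀) h216R3 X B)
    hc0 hc hαc hΓq (lt_of_le_of_lt hsmall (by norm_num))

/-- **(2.26) FOR THE TYPED TERM (2.14) FROM THE PRIMITIVE OBJECTS — WITHOUT THE REGULARITY HYPOTHESES `hΨσ`, `hΨτ`.**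
See the module docstring for the three changes to `norm_term214_le_226_of_primitives`'s hypothesis list; the conclusion and
every constant are identical.  `h220U` (one open `Uτ` for all domains) is torus-uniform only in the per-coordinate version
(cell record (x8)); across-tori consumers wait for the `SepHolOnPoly` form. [cite: Balaban1988RG2Cluster, (2.14)–(2.15) p.15, (2.16)–(2.22) p.16, (2.23)–(2.26) p.17] -/
theorem norm_term214_le_226_of_primitives_holo (hρ : WeightHyp 0 ρ) (hρs : ∀ x y : S, ρ x y = ρ y x)
    (hKc : ∀ b : ℝ, 0 < b → ∀ (T : Finset S) (x : S), ∑ y ∈ T, Real.exp (-(b * ρ x y)) ≤ Kc b)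
    (hKc0 : ∀ b : ℝ, 0 < b → 0 ≤ Kc b)
    {κ₁ : ℝ} (hκ₁ : 1 ≤ κ₁) (Rτ : κ → ℝ) (hRτ : ∀ Y, 2 ≤ Rτ Y)
    {Uσ Uτ : Set ℂ} (hUσ : IsOpen Uσ) (hUτ : IsOpen Uτ) (hUexp : closedBall (0 : ℂ) (Real.exp κ₁) ⊆ Uσ)
    (hUtau : ∀ Y, closedBall (0 : ℂ) (Rτ Y) ⊆ Uτ) {r : ℝ} (hr : 0 < r) (hr' : r ≤ Real.exp κ₁ - 1)
    (hsubτ : ∀ s ∈ Set.uIcc (0 : ℝ) 1, closedBall (s : ℂ) r ⊆ Uτ)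
    (A : (ι → ℂ) → Matrix Λ Λ ℂ) (Γ : (ι → ℂ) → (Λ ⊕ C₀ → ℝ) → (Λ → ℂ))
    (cardP : ℕ) (χY₀ χcP : (Λ → ℝ) → ℝ) (hχ0 : ∀ B, 0 ≤ χY₀ B) (hχc0 : ∀ B, 0 ≤ χcP B) (Dfam : Finset κ)
    (V : κ → (Λ → ℝ) → ℂ)
    {C : Matrix Λ Λ ℝ} (hC : C.PosDef) (Γ₀ : Matrix Λ (Λ ⊕ C₀) ℝ)
    -- NEW (replaces hΨσ ∕ hΨτ): entrywise holomorphy of the primitive kernels on the OPEN σ-polydisc, measurability of the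
    -- last line's ingredients, (2.20) uniformly on the τ-polydisc (cell record (x8)); the σ-letters below on the open polydisc
    (hAhol : ∀ i j, DifferentiableOn ℂ (fun σ => A σ i j) {σ | ∀ j, σ j ∈ Uσ})
    (hχm : Measurable χY₀) (hχcm : Measurable χcP) (hVm : ∀ Y, Measurable (V Y))
    (hAs : ∀ σ : ι → ℂ, (∀ j, σ j ∈ Uσ) → (A σ).IsSymm)
    (hA : ∀ σ : ι → ℂ, (∀ j, σ j ∈ Uσ) → ((A σ).map Complex.re).PosDef)
    -- the Γ-operator is linear with kernel G(σ)
    (G : (ι → ℂ) → Matrix Λ (Λ ⊕ C₀) ℂ)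
    (hGhol : ∀ i j, DifferentiableOn ℂ (fun σ => G σ i j) {σ | ∀ j, σ j ∈ Uσ})
    (hlin : ∀ σ : ι → ℂ, (∀ j, σ j ∈ Uσ) → ∀ X : Λ ⊕ C₀ → ℝ, Γ σ X = G σ *ᵥ fun j => (X j : ℂ))
    {γ₂ rP a w : ℝ} (qP : (Λ → ℝ) → ℝ)
    (h222 : ∀ B, χY₀ B * χcP B ≤ Real.exp (-(γ₂ / 2 * rP ^ 2 * cardP) + γ₂ / 2 * qP B)) (hγ₂ : 0 ≤ γ₂)
    (hqP : ∀ B, qP B ≤ B ⬝ᵥ B) (ha0 : 0 ≤ a)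
    (h220U : ∀ τ : κ → ℂ, (∀ Y, τ Y ∈ Uτ) → ∀ B, ∑ Y ∈ Dfam, ‖τ Y‖ * ‖V Y B‖ ≤ a / 2 * (B ⬝ᵥ B) + w)
    -- located bonds
    (locΛ : Λ → S) (locN : Λ ⊕ C₀ → S) {m : ℕ}
    (hfibΛ : ∀ x : S, (Finset.univ.filter fun i => locΛ i = x).card ≤ m)
    (hfibN : ∀ x : S, (Finset.univ.filter fun j => locN j = x).card ≤ m)
    -- rates and constants
    {kap kap' kap'' θ θE θΓ θC KG KΓ KCs K₀ : ℝ} (hkap'' : 0 < kap'') (h1 : kap'' < kap') (h2 : kap' < kap)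
    (hθE : 0 ≤ θE) (hθΓ : 0 ≤ θΓ) (hθC : 0 ≤ θC) (hKG : 0 ≤ KG) (hKΓ : 0 ≤ KΓ) (hKCs : 0 ≤ KCs) (hK₀ : 0 ≤ K₀)
    (hθEle : θE ≤ θ) (hθΓle : θΓ ≤ θ)
    (hθR1le : (m * Kc (kap - kap')) * (m * Kc (kap' - kap''))
      * (θΓ * KCs * KG + KΓ * θC * KG + KΓ * K₀ * θΓ) ≤ θ)
    -- uniform localisation of the primitive kernels (L17a)
    (hG : ∀ σ : ι → ℂ, (∀ j, σ j ∈ Uσ) →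
      ∀ b j, ‖G σ b j‖ ≤ KG * Real.exp (-(kap * ρ (locΛ b) (locN j))))
    (hΓ₀ : ∀ b j, ‖Γ₀ b j‖ ≤ KΓ * Real.exp (-(kap * ρ (locΛ b) (locN j))))
    (hCs : ∀ σ : ι → ℂ, (∀ j, σ j ∈ Uσ) →
      ∀ b b', ‖(A σ)⁻¹ b b'‖ ≤ KCs * Real.exp (-(kap * ρ (locΛ b) (locΛ b'))))
    (hC216 : ∀ b b', ‖C b b'‖ ≤ K₀ * Real.exp (-(kap * ρ (locΛ b) (locΛ b'))))
    -- the (2.16)-type differences of the primitive kernels (L16a)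
    (hdΓ : ∀ σ : ι → ℂ, (∀ j, σ j ∈ Uσ) →
      ∀ b j, ‖(G σ - Γ₀.map (algebraMap ℝ ℂ)) b j‖ ≤ θΓ * Real.exp (-(kap * ρ (locΛ b) (locN j))))
    (hdC : ∀ σ : ι → ℂ, (∀ j, σ j ∈ Uσ) →
      ∀ b b', ‖((A σ)⁻¹ - C.map (algebraMap ℝ ℂ)) b b'‖ ≤ θC * Real.exp (-(kap * ρ (locΛ b) (locΛ b'))))
    (hdE : ∀ σ : ι → ℂ, (∀ j, σ j ∈ Uσ) →
      ∀ b b', ‖(A σ - C⁻¹.map (algebraMap ℝ ℂ)) b b'‖ ≤ θE * Real.exp (-(kap * ρ (locΛ b) (locΛ b'))))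
    (hsmallKθ : K₀ * (m * Kc kap) * (θ * (m * Kc kap'')) < 1)
    -- the (2.24)–(2.25) smallness
    {c g : ℝ} (hc0 : 0 ≤ c) (hc : ∀ k, hC.1.eigenvalues k ≤ c)
    (hαc : (2 * (θ * (m * Kc kap'')) + (γ₂ + a)) * c ≤ 1 / 2) (hg : 0 ≤ g)
    (hΓq : ∀ X : Λ ⊕ C₀ → ℝ, (Γ₀ *ᵥ X) ⬝ᵥ (C *ᵥ (Γ₀ *ᵥ X)) ≤ g * (X ⬝ᵥ X))
    (hsmall : (2 * (θ * (m * Kc kap'')) + (γ₂ + a)) * (1 + 2 * c * g) ≤ 1 / 2)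
    {lZ : List ι} (hlZ : lZ.Nodup) {lD : List κ} (hlD : lD.Nodup)
    {σ₀ : ι → ℂ} (hσ₀ : ∀ j, ‖σ₀ j‖ ≤ 1) {τ₀ : κ → ℂ} (hτ₀ : ∀ Y, ‖τ₀ Y‖ ≤ 1) :
    ‖term214 r lZ lD (core214 A Γ (F214 cardP χY₀ χcP Dfam V)) σ₀ τ₀‖ ≤
      Real.exp (-(κ₁ - 1) * lZ.length) * (∏ Y ∈ lD.toFinset, 2 * (Rτ Y)⁻¹)
        * (Real.exp (2 * (K₀ * (m * Kc kap) * (θ * (m * Kc kap''))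
              * (1 + (1 - K₀ * (m * Kc kap) * (θ * (m * Kc kap'')))⁻¹) / 2) * Fintype.card Λ)
          * Real.exp (-(γ₂ / 2 * rP ^ 2 * cardP) + w)
          * (Real.exp ((2 * (θ * (m * Kc kap'')) + (γ₂ + a)) * c * Fintype.card Λ)
            * Real.exp ((2 * (θ * (m * Kc kap'')) + (γ₂ + a)) * (1 + 2 * c * g)
              * Fintype.card (Λ ⊕ C₀))))  := by
  have hin : ∀ σ : ι → ℂ, (∀ j, ‖σ j‖ ≤ Real.exp κ₁) → ∀ j, σ j ∈ Uσ :=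
    fun σ hσ j => hUexp (mem_closedBall_zero_iff.2 (hσ j))
  have ha2 : 0 ≤ γ₂ + a := add_nonneg hγ₂ ha0
  -- the capstone's `h220R` ((2.20) at the radii `R_τ(Y)`) is the point `τ = (R_τ(Y))_Y` of the τ-polydisc (r10 S-1)
  have hR0 : ∀ Y, 0 ≤ Rτ Y := fun Y => by linarith [hRτ Y]
  have h220R : ∀ B, ∑ Y ∈ Dfam, Rτ Y * ‖V Y B‖ ≤ a / 2 * (B ⬝ᵥ B) + w := by
    intro B
    have e : ∀ Y, ‖((Rτ Y : ℝ) : ℂ)‖ = Rτ Y := fun Y => by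
      rw [Complex.norm_real, Real.norm_of_nonneg (hR0 Y)]
    have h := h220U (fun Y => ((Rτ Y : ℝ) : ℂ))
      (fun Y => hUtau Y (mem_closedBall_zero_iff.2 (by rw [e Y]))) B
    simpa only [e] using h
  refine norm_term214_le_226_of_primitives hρ hρs hKc hKc0 hκ₁ Rτ hRτ hUσ hUτ hUexp hUtau hr hr' hsubτ A Γ cardP χY₀
    χcP hχ0 hχc0 Dfam V (fun τ hτ => ?_) (fun σ hσ => ?_) hC Γ₀ (fun σ hσ => hAs σ (hin σ hσ))
    (fun σ hσ => hA σ (hin σ hσ)) G (fun σ hσ => hlin σ (hin σ hσ)) qP h222 hγ₂ hqP h220R ha0 locΛ locN hfibΛ hfibN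
    hkap'' h1 h2 hθE hθΓ hθC hKG hKΓ hKCs hK₀ hθEle hθΓle hθR1le (fun σ hσ => hG σ (hin σ hσ)) hΓ₀
    (fun σ hσ => hCs σ (hin σ hσ)) hC216 (fun σ hσ => hdΓ σ (hin σ hσ)) (fun σ hσ => hdC σ (hin σ hσ))
    (fun σ hσ => hdE σ (hin σ hσ)) hsmallKθ hc0 hc hαc hg hΓq hsmall hlZ hlD hσ₀ hτ₀
  · -- the σ-slot at this τ
    exact sepHolOn_core214_sigma_of_primitives hρ hρs hKc hKc0 hUσ A Γ G hAhol hGhol hAs hA hlin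
      (F214 cardP χY₀ χcP Dfam V) τ (measurable_F214 cardP hχm hχcm Dfam hVm τ).stronglyMeasurable
      (K := Real.exp (-(γ₂ / 2 * rP ^ 2 * cardP) + w)) (Real.exp_pos _).le ha2
      (fun B => norm_F214_le cardP χY₀ χcP Dfam V τ qP B (hχ0 B) (hχc0 B) (h222 B) hγ₂ (hqP B) (h220U τ hτ B))
      hC Γ₀ locΛ locN hfibΛ hfibN hkap'' h1 h2 hθE hθΓ hθC hKG hKΓ hKCs hK₀ hθEle hθΓle hθR1le hG hΓ₀ hCs hC216 hdΓ
      hdC hdE hsmallKθ hc0 hc hαc hΓq hsmall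
  · -- the τ-slot at this σ
    exact sepHolOn_core214_tau_of_primitives hρ hρs hKc hKc0 hUτ A Γ G σ (hAs σ hσ) (hA σ hσ) (hlin σ hσ) cardP hχm
      hχcm hχ0 hχc0 Dfam hVm qP h222 hγ₂ hqP ha0 h220U hC Γ₀ locΛ locN hfibΛ hfibN hkap'' h1 h2 hθE hθΓ hθC hKG hKΓ
      hKCs hK₀ hθEle hθΓle hθR1le (hG σ hσ) hΓ₀ (hCs σ hσ) hC216 (hdΓ σ hσ) (hdC σ hσ) (hdE σ hσ) hsmallKθ hc0 hc hαc
      hΓq hsmall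

end Literature.MathematicalPhysics.QuantumFieldTheory.Balaban1983to89.B13Core214HolomorphicCapstone

end
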